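import Literature.MathematicalPhysics.QuantumFieldTheory.Balaban1983to89.B12NodeKnitContinuousTransport

/-!
# NODE N09 · [Balaban1987RG1] p. 254 ∕ p. 263 ∕ (2.16) p. 269 FOR TRANSPORTS CONTINUOUS ON THE SMALL-FIELD DOMAINS ONLY — the ON-DOMAIN twin of
# `B12ContinuousTransportInvariance`: gauge invariance of continuous renormalisation images ON AN OPEN GAUGE-STABLE SET, the effective actions invariant ON THE
# DOMAINS, and N09's composition input `HCompT` from the [B11] inputs + the nesting «averaged minimisers of small fields are small-field»

T. Bałaban, *Renormalization group approach to lattice gauge field theories. I*, Commun. Math. Phys. **109** (1987) 249–301 [Balaban1987RG1] (= [I]);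
[Balaban1985Variational] (= [B11], CMP 102) Thm 1 p. 279; [Balaban1985Averaging] (= [B7], CMP 98) (10) p. 19.  TRACK A (YM-PLAN §2b, node N09 of 28), seat
`pub-ymgap-dag-n09-a` (prover, KNIT-BY-NAME; HUMAN RULING D-0062), generation g4, MODULE 5 (imports MODULE 2 `B12NodeKnitContinuousTransport`).  THEOREMS ONLY,
def-free, sorry-free, standard axioms.

WHY.  MODULE 1 (`B12ContinuousTransportInvariance`) ∕ MODULE 2 (`B12NodeKnitContinuousTransport`) make N09's middle composition clauses theorems over a transport
whose images of the (0.19) densities are continuous EVERYWHERE (node00-def-T's `TcOfRecord` under `HasContTransportAlong`, the everywhere form Record10 carries as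
`Provisos₁₀.contT`).  With the SHARP small-field indicator χ of record, everywhere-continuity of the (0.13) fibre integral of `χ_k e^{…}` asks the boundary of the
small-field set to be fibre-null at EVERY coarse field; print works on the analyticity DOMAINS of `A_{k+1}` ([I] pp. 259–260, p. 263 «the action A_k(U) defined on
the space U_k(ε₀) … is gauge invariant»), and the route's plan prefers an ON-DOMAIN proviso (`HasContVersionOn`, pub-ymgap plan g62 ∕ ref-D (L2) ∕ ref-C READ92
NOTE, 2026-08-26).  THIS FILE shows N09's chain needs continuity ONLY ON THE SMALL-FIELD DOMAINS: if `D_j ⊆ GaugeField P j G` are OPEN, GAUGE-STABLE sets off which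
`χ_j` VANISHES (for def-χ's `chiFixed7`: `D_j` = the record's own `domAltOfRecord ν K j`, `chiFixAltOfRecord_eq_one_iff_mem`), then

* §1 (generic `G`): **`invOn_of_ae_of_continuousOn`** — a function continuous ON an open gauge-stable set `D` and a.e.-invariant under each gauge transformation (open-
  positive measure, continuous action) is invariant AT EVERY POINT OF `D` (Mathlib `Measure.eqOn_open_of_ae_eq`); **`invOn_of_isRT_of_continuousOn`** — p. 254 ON `D`:
  an integrable `IsRT` image of a lift-invariant density, continuous on `D`, satisfies `ρ'(V^v) = ρ'(V)` for every `V ∈ D`; **`liftInvariant_integrand_of_invOn`** —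
  the (0.19) density `χ·e^{−GF/g²+A}` is lift-invariant GLOBALLY as soon as `A` is invariant ON `D`, `χ`, `GF` are lift-invariant and `χ` vanishes off `D`
  (off `D` both sides are `0`) — so the push-forward argument (`isRT_comp_gaugeAct`, which needs global lift-invariance of the FINE density) still runs.
* §2 (`G = SU(N)`, transport families): `stepInvOn_of_isRT_continuousOn` (the per-step ON-DOMAIN mapping property from §1), **`invOn_effActionHT_of_stepsOn`** (p. 263
  in its printed, on-domain form: every `A_k`, `k ≤ n`, is invariant ON `D_k` — `A_0` everywhere), `liftInvariant_integrand_of_stepsOn`, **`hCompT_of_hOrbit_of_invOn`**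
  (the composition input from `HOrbit` + on-domain invariance + the NESTING binder `Ū^j(U_k V) ∈ D_j` for `V ∈ dom_k`, `j < k` — print: the averaged regular
  minimiser is small-field, [I] (1.2) p. 260 ∕ [B11] Thm 1), **`hCompT_of_stepsOn`**, **`indAOfRecordT_atRecord_of_stepsOn`** ((1.3)∕(0.23) at the record over such a
  transport from χ-locality, `RGEqH`, (1.1), `HRestrict`, intermediate uniqueness, nesting and the on-domain per-step property).
* §3 plug: **`thm3Member_of_indATPlug_of_stepsOn`**, `b12_main_of_indATPlug_of_leaf_of_stepsOn` (the Theorem-3 member ∕ N09 at a binding world whose `IndAss` reads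
  `IndAOfRecordT T' χ ε β …`, from the [B11] binders + nesting + the on-domain per-step property).
* §4 AT def-χ's χ AND THE RECORD'S OWN DOMAINS (`chiFixed7 ν`, `D j := Node00.domAltOfRecord ν K j`): the bookkeeping hypotheses of §2–§3 are THEOREMS —
  `continuous_dist1_SU`, `continuous_plaqHol_SU`, **`isOpen_domAltOfRecord`** (strict plaquette inequalities), **`domAltOfRecord_gaugeAct_mem`** (gauge-stable,
  `T4ReTrLipUnitary.plaqSmall_gaugeAct_iff`), **`chiFixed7_eq_zero_of_not_mem`** (χ vanishes off the domain; lift-invariance is MODULE 2's `liftInvariant_chiFixed7`); hence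
  **`hCompT_of_stepsOn_chiFixed7`** ∕ **`thm3Member_of_indATPlug_of_stepsOn_chiFixed7`**: over ANY transport family, the composition input ∕ the member from the [B11]
  binders, the nesting `Ū^j(U_k V) ∈ domAltOfRecord ν K j`, and PER STEP ONLY «`T K j ρ_j` is an integrable `IsRT` image, continuous ON `domAltOfRecord ν K (j+1)`».

So a successor record that certifies continuous versions of the transforms ON `domAltOfRecord` only (the plan's preferred K0 content) feeds N09's member through this
file exactly as Record10's everywhere-form `contT` feeds MODULE 2; the ONE extra binder is the located nesting of the small-field domains along the averaged minimisers.
HONEST FRAMING: count-neutral kernel bookkeeping; the on-domain continuity, the `IsRT`∕integrability of the images, the nesting and the [B11] inputs are HYPOTHESES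
(located: p. 254, pp. 259–260, p. 263, (2.16) p. 269; [B11] Thm 1 p. 279); nothing of Bałaban's asserted; no estimate; N09 NOT discharged; conjunct 1 untouched; one
finite four-torus programme at fixed ε per run — NOT ℝ⁴, NOT infinite volume, NOT OS axioms, NOT a mass gap, NOT Clay.
-/

noncomputable section

namespace Literature.MathematicalPhysics.QuantumFieldTheory.Balaban1983to89.B12ContinuousTransportInvarianceOn

open MeasureTheory
open DagBinding Node00 T4Continuum
open FlowStep (HBeta prefixOf RGEqH)
open FlowStepRuns (genSeq genFlow)
open T4FlagMemory (extd)
open B12Eq019ActionBody (integrand integrand_apply nextAction_apply)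
open B12RTGaugeInvariance254 (LiftInvariant liftTransf liftInvariant_of_gaugeInvariant isRT_comp_gaugeAct ae_eq_of_isRT integrable_comp_gaugeAct)
open GaugeField (GaugeInvariant gaugeAct)
open B12EffectiveActionInvarianceT (gfOfRecord_liftInvariant)
open B12ContinuousTransportInvariance (continuous_gaugeAct isOpenPosMeasure_fieldMeasure_SU continuous_gaugeAct_SU)
open B12NodeKnitRecord8 (b12_main_of_leaf_of_thm3Member)
open B12NodeKnitIndAPlug (thm3Member_of_indATPlug_of_hCompT)

/-! ## §1. Generic gauge group: invariance ON an open gauge-stable set from a.e.-invariance and continuity there -/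

section Generic

variable {P : Params} {j : ℕ} {G : Type*} [GaugeGroup G] [TopologicalSpace G] [MeasurableSpace G] [HaarData G]

/-- **A.E.-INVARIANT + CONTINUOUS ON AN OPEN GAUGE-STABLE SET ⇒ INVARIANT THERE.**  If `ρ` is continuous on the open set `D`, `D` is stable under every gauge
transformation, each gauge transformation acts continuously, `dU` charges every non-empty open set, and `ρ(U^u) = ρ(U)` for `dU`-a.e. `U` for each `u`, then
`ρ(U^u) = ρ(U)` for EVERY `U ∈ D` (Mathlib `Measure.eqOn_open_of_ae_eq`: two functions a.e. equal on an open set and continuous there agree on it).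
[cite: Balaban1987RG1, (0.13) p.254 and p.263] -/
theorem invOn_of_ae_of_continuousOn [(fieldMeasure P j G).IsOpenPosMeasure]
    (hact : ∀ u : GaugeTransf P j G, Continuous (gaugeAct u : GaugeField P j G → GaugeField P j G))
    {D : Set (GaugeField P j G)} (hD : IsOpen D) (hDst : ∀ (u : GaugeTransf P j G) (U : GaugeField P j G), U ∈ D → gaugeAct u U ∈ D)
    {ρ : Density P j G} (hc : ContinuousOn ρ D) (hae : ∀ u : GaugeTransf P j G, (fun U => ρ (gaugeAct u U)) =ᵐ[fieldMeasure P j G] ρ) :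
    ∀ (u : GaugeTransf P j G) (U : GaugeField P j G), U ∈ D → ρ (gaugeAct u U) = ρ U := fun u _ hU =>
  Measure.eqOn_open_of_ae_eq (ae_restrict_of_ae (hae u)) hD (hc.comp (hact u).continuousOn fun V hV => hDst u V hV) hc hU

variable [MeasurableMul₂ G]

/-- **p. 254 ON AN OPEN GAUGE-STABLE SET**: in the standing range `j + 1 ≤ m + K`, for a covariant averaging `av`, an `IsRT` image `ρ'` of a LIFT-invariant `ρ` that is
integrable and CONTINUOUS ON the open gauge-stable set `D` of coarse fields satisfies `ρ'(V^v) = ρ'(V)` for every `V ∈ D` and every coarse `v` (a.e. by `isRT_comp_gaugeAct`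
+ `ae_eq_of_isRT`, on `D` by `invOn_of_ae_of_continuousOn`). [cite: Balaban1987RG1, (0.13) p.254, (2.1) p.265 and p.263] -/
theorem invOn_of_isRT_of_continuousOn [(fieldMeasure P (j+1) G).IsOpenPosMeasure]
    (hact : ∀ v : GaugeTransf P (j+1) G, Continuous (gaugeAct v : GaugeField P (j+1) G → GaugeField P (j+1) G))
    (hj : j + 1 ≤ P.m + P.K) (av : Averaging P j G) {ρ : Density P j G} {ρ' : Density P (j+1) G} (h : IsRT av.avg ρ ρ')
    (hρ : LiftInvariant ρ) (hi : Integrable ρ' (fieldMeasure P (j+1) G)) {D : Set (GaugeField P (j+1) G)} (hD : IsOpen D)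
    (hDst : ∀ (v : GaugeTransf P (j+1) G) (V : GaugeField P (j+1) G), V ∈ D → gaugeAct v V ∈ D) (hc : ContinuousOn ρ' D) :
    ∀ (v : GaugeTransf P (j+1) G) (V : GaugeField P (j+1) G), V ∈ D → ρ' (gaugeAct v V) = ρ' V :=
  invOn_of_ae_of_continuousOn hact hD hDst hc fun v =>
    ae_eq_of_isRT (isRT_comp_gaugeAct hj av h hρ v) h (integrable_comp_gaugeAct hi v) hi

omit [TopologicalSpace G] [MeasurableSpace G] [HaarData G] [MeasurableMul₂ G] in
/-- **THE (0.19) DENSITY IS LIFT-INVARIANT GLOBALLY FROM ON-DOMAIN INVARIANCE OF `A`**: if `χ` and `GF` are lift-invariant, `χ` VANISHES off a set `D`, and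
`A(U^ṽ) = A(U)` for `U ∈ D` (no stability of `D` needed: off `D` both sides vanish), then `χ(U)·exp[−(1/g²)GF(U) + A(U)]` is lift-invariant at EVERY `U` (off `D` both sides vanish).  This is what
lets the push-forward argument run with `A_k` known invariant only on the small-field domain of `χ_k`. [cite: Balaban1987RG1, (0.19) p.255 and p.263] -/
theorem liftInvariant_integrand_of_invOn {χ GF A : Density P j G} (hχ : LiftInvariant χ) (hGF : LiftInvariant GF) {D : Set (GaugeField P j G)}
    (hχD : ∀ U, U ∉ D → χ U = 0)
    (hA : ∀ (v : GaugeTransf P (j+1) G) (U : GaugeField P j G), U ∈ D → A (gaugeAct (liftTransf v) U) = A U) (gk : ℝ) :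
    LiftInvariant (integrand χ GF gk A) := by
  intro v U
  rw [integrand_apply, integrand_apply, hχ v U, hGF v U]
  by_cases hU : U ∈ D
  · rw [hA v U hU]
  · have h0 : χ U = 0 := hχD U hU
    rw [h0, zero_mul, zero_mul]

end Generic

/-! ## §2. `G = SU(N)`: the on-domain per-step property, p. 263 on the domains, `HCompT` from `HOrbit` + on-domain invariance + nesting -/

variable {F : T4Family} {N : ℕ} [NeZero N]

/-- **THE PER-STEP ON-DOMAIN MAPPING PROPERTY FROM §1** (transport family `T`, torus `K`, step `j + 1 ≤ m + K`): if the image under `T K j` of the (0.19) density met at step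
`j` is an `IsRT` image of it, integrable, and CONTINUOUS ON an open gauge-stable set `D` of coarse fields, then lift-invariance of that density gives invariance of the image
AT EVERY POINT OF `D`. [cite: Balaban1987RG1, (0.13) p.254, (0.19) p.255 and p.263] -/
theorem stepInvOn_of_isRT_continuousOn (T : Transport F N) (χ : (K : ℕ) → (ℕ → ℝ) → (k : ℕ) → Density (F.P K) k (SU N)) (K : ℕ) (g : ℕ → ℝ)
    {j : ℕ} (hj : j + 1 ≤ (F.P K).m + (F.P K).K) {D : Set (GaugeField (F.P K) (j + 1) (SU N))} (hD : IsOpen D)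
    (hDst : ∀ (v : GaugeTransf (F.P K) (j + 1) (SU N)) (V : GaugeField (F.P K) (j + 1) (SU N)), V ∈ D → gaugeAct v V ∈ D)
    (hRT : IsRT (avOfRecord F N K j).avg (integrand (χ K g j) (gfOfRecord F N K j) (g j) (effActionHT F N T χ K g j))
      (T K j (integrand (χ K g j) (gfOfRecord F N K j) (g j) (effActionHT F N T χ K g j))))
    (hint : Integrable (T K j (integrand (χ K g j) (gfOfRecord F N K j) (g j) (effActionHT F N T χ K g j))) (fieldMeasure (F.P K) (j + 1) (SU N)))
    (hcont : ContinuousOn (T K j (integrand (χ K g j) (gfOfRecord F N K j) (g j) (effActionHT F N T χ K g j))) D) :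
    LiftInvariant (integrand (χ K g j) (gfOfRecord F N K j) (g j) (effActionHT F N T χ K g j)) →
      ∀ (v : GaugeTransf (F.P K) (j + 1) (SU N)) (V : GaugeField (F.P K) (j + 1) (SU N)), V ∈ D →
        T K j (integrand (χ K g j) (gfOfRecord F N K j) (g j) (effActionHT F N T χ K g j)) (gaugeAct v V) =
          T K j (integrand (χ K g j) (gfOfRecord F N K j) (g j) (effActionHT F N T χ K g j)) V := fun hρ =>
  haveI := isOpenPosMeasure_fieldMeasure_SU N (F.P K) (j + 1)
  invOn_of_isRT_of_continuousOn (continuous_gaugeAct_SU N (F.P K) (j + 1)) hj (avOfRecord F N K j) hRT hρ hint hD hDst hcont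

/-- **ONE STEP OF (0.19) ON THE DOMAIN**: if `T K j` sends the density met at step `j` to a function invariant on `D`, then `A_{j+1} = log 𝐍_j⁻¹ (T K j ρ_j)(·)` is invariant on
`D`. [cite: Balaban1987RG1, (0.19) p.255 and p.263] -/
theorem invOn_effActionHT_succ_of_stepOn (T : Transport F N) (χ : (K : ℕ) → (ℕ → ℝ) → (k : ℕ) → Density (F.P K) k (SU N)) (K : ℕ) (g : ℕ → ℝ) (j : ℕ)
    {D : Set (GaugeField (F.P K) (j + 1) (SU N))}
    (hTj : ∀ (v : GaugeTransf (F.P K) (j + 1) (SU N)) (V : GaugeField (F.P K) (j + 1) (SU N)), V ∈ D →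
      T K j (integrand (χ K g j) (gfOfRecord F N K j) (g j) (effActionHT F N T χ K g j)) (gaugeAct v V) =
        T K j (integrand (χ K g j) (gfOfRecord F N K j) (g j) (effActionHT F N T χ K g j)) V) :
    ∀ (v : GaugeTransf (F.P K) (j + 1) (SU N)) (V : GaugeField (F.P K) (j + 1) (SU N)), V ∈ D →
      effActionHT F N T χ K g (j + 1) (gaugeAct v V) = effActionHT F N T χ K g (j + 1) V := by
  intro v V hV
  rw [effActionHT_succ, nextAction_apply, nextAction_apply, hTj v V hV]

/-- **THE EFFECTIVE ACTIONS ARE GAUGE INVARIANT ON THE DOMAINS (p. 263 «the action A_k(U) defined on the space U_k(ε₀) … is gauge invariant»)**: for `n ≤ m + K`,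
bookkeeping sets `D j` with `χ_j` lift-invariant and VANISHING off `D j` (`j < n`), and the on-domain
per-step property at the densities met (`T K j ρ_j` invariant on `D (j+1)` whenever `ρ_j` is lift-invariant, `j < n`), every `A_k`, `k ≤ n`, satisfies
`A_k(V^v) = A_k(V)` for all `V ∈ D k` (and `A_0` everywhere) — induction on `k` from `A_0 = −(1/g_0²)A^η` with §1's `liftInvariant_integrand_of_invOn`.
[cite: Balaban1987RG1, p.263, (0.13) p.254 and (0.19) p.255] -/
theorem invOn_effActionHT_of_stepsOn (T : Transport F N) (χ : (K : ℕ) → (ℕ → ℝ) → (k : ℕ) → Density (F.P K) k (SU N)) (K : ℕ) (g : ℕ → ℝ)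
    {n : ℕ} (hn : n ≤ (F.P K).m + (F.P K).K) (D : (j : ℕ) → Set (GaugeField (F.P K) j (SU N)))
    (hχ : ∀ j < n, LiftInvariant (χ K g j)) (hχD : ∀ j < n, ∀ U, U ∉ D j → χ K g j U = 0)
    (hstep : ∀ j < n, LiftInvariant (integrand (χ K g j) (gfOfRecord F N K j) (g j) (effActionHT F N T χ K g j)) →
      ∀ (v : GaugeTransf (F.P K) (j + 1) (SU N)) (V : GaugeField (F.P K) (j + 1) (SU N)), V ∈ D (j + 1) →
        T K j (integrand (χ K g j) (gfOfRecord F N K j) (g j) (effActionHT F N T χ K g j)) (gaugeAct v V) =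
          T K j (integrand (χ K g j) (gfOfRecord F N K j) (g j) (effActionHT F N T χ K g j)) V) :
    ∀ k ≤ n, ∀ (v : GaugeTransf (F.P K) k (SU N)) (V : GaugeField (F.P K) k (SU N)), V ∈ D k →
      effActionHT F N T χ K g k (gaugeAct v V) = effActionHT F N T χ K g k V := by
  intro k
  induction k with
  | zero =>
    intro _ v V _
    rw [effActionHT_zero]
    exact T4WilsonGaugeFlatDirection.gaugeInvariant_wilsonExponent _ _ v V
  | succ k ih =>
    intro hk
    have hk' : k < n := Nat.lt_of_succ_le hk
    refine invOn_effActionHT_succ_of_stepOn T χ K g k (hstep k hk' ?_)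
    exact liftInvariant_integrand_of_invOn (hχ k hk') (gfOfRecord_liftInvariant F N K ((Nat.succ_le_of_lt hk').trans hn))
      (hχD k hk') (fun v U hU => ih hk'.le (liftTransf v) U hU) (g k)

/-- Under the same hypotheses every (0.19) density met at a step `j < n` IS lift-invariant (globally). [cite: Balaban1987RG1, (0.19) p.255 and p.263] -/
theorem liftInvariant_integrand_of_stepsOn (T : Transport F N) (χ : (K : ℕ) → (ℕ → ℝ) → (k : ℕ) → Density (F.P K) k (SU N)) (K : ℕ) (g : ℕ → ℝ)
    {n : ℕ} (hn : n ≤ (F.P K).m + (F.P K).K) (D : (j : ℕ) → Set (GaugeField (F.P K) j (SU N)))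
    (hχ : ∀ j < n, LiftInvariant (χ K g j)) (hχD : ∀ j < n, ∀ U, U ∉ D j → χ K g j U = 0)
    (hstep : ∀ j < n, LiftInvariant (integrand (χ K g j) (gfOfRecord F N K j) (g j) (effActionHT F N T χ K g j)) →
      ∀ (v : GaugeTransf (F.P K) (j + 1) (SU N)) (V : GaugeField (F.P K) (j + 1) (SU N)), V ∈ D (j + 1) →
        T K j (integrand (χ K g j) (gfOfRecord F N K j) (g j) (effActionHT F N T χ K g j)) (gaugeAct v V) =
          T K j (integrand (χ K g j) (gfOfRecord F N K j) (g j) (effActionHT F N T χ K g j)) V) :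
    ∀ j < n, LiftInvariant (integrand (χ K g j) (gfOfRecord F N K j) (g j) (effActionHT F N T χ K g j)) := fun j hj =>
  liftInvariant_integrand_of_invOn (hχ j hj) (gfOfRecord_liftInvariant F N K ((Nat.succ_le_of_lt hj).trans hn)) (hχD j hj)
    (fun v U hU => invOn_effActionHT_of_stepsOn T χ K g hn D hχ hχD hstep j hj.le (liftTransf v) U hU) (g j)

/-- **N09's COMPOSITION INPUT `HCompT` FROM `HOrbit`, ON-DOMAIN INVARIANCE OF THE ACTIONS AND THE NESTING OF THE SMALL-FIELD DOMAINS** (level `k ≤ m + K` of the `K`-th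
torus, domain `dom`): if `A_j`, `j < k`, is invariant on `D j` under the gauge group of `T⁽ʲ⁾`, and the averaged minimiser `Ū^j(U_k V)` of every `V ∈ dom` lies in
`D j` (print: `U_k V ∈ U_k(ε₀)` is regular, so its averages are small-field — [I] (1.2) p. 260, [B11] Thm 1 (9)), then `HOrbit` ([I] (1.1): one residual orbit) gives
`HCompT` — by the covariance of the iterated averages `Ū^j(U^u) = (Ū^j U)^{u↾T⁽ʲ⁾}` (`B16Sect1Backgrounds.iter_gaugeAct`) at the orbit points.
[cite: Balaban1987RG1, (0.21)–(0.23) p.256, (1.1)–(1.2) p.260 and (2.16) p.269; Balaban1985Variational, Thm 1 (9) p.279] -/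
theorem hCompT_of_hOrbit_of_invOn (T : Transport F N) (χ : (K : ℕ) → (ℕ → ℝ) → (k : ℕ) → Density (F.P K) k (SU N)) {ε : ℝ} (K : ℕ)
    (g : ℕ → ℝ) {k : ℕ} (hk : k ≤ (F.P K).m + (F.P K).K) {dom : Set (GaugeField (F.P K) k (SU N))} (hO : HOrbit F N ε K k dom)
    (D : (j : ℕ) → Set (GaugeField (F.P K) j (SU N)))
    (hinv : ∀ j < k, ∀ (v : GaugeTransf (F.P K) j (SU N)) (W : GaugeField (F.P K) j (SU N)), W ∈ D j →
      effActionHT F N T χ K g j (gaugeAct v W) = effActionHT F N T χ K g j W)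
    (hnest : ∀ V ∈ dom, ∀ j < k, Averaging.iter (avOfRecord F N K) j (Uk F N K k ε V) ∈ D j) :
    HCompT F N T χ ε K g k dom := by
  intro V hV j hj
  obtain ⟨u, -, hEq⟩ := hO V hV j hj
  rw [hEq, B16Sect1Backgrounds.iter_gaugeAct (avOfRecord F N K) u _ j (hj.le.trans hk)]
  exact hinv j hj (B16Sect1Backgrounds.toMS u j) _ (hnest V hV j hj)

/-- **`HCompT` FROM THE [B11] INPUTS + NESTING + THE ON-DOMAIN PER-STEP PROPERTY** at every level `k ≤ n` (`n ≤ K`): `HRestrict` + intermediate (1.1)-uniqueness ⇒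
`HOrbit` (`Node00.hOrbit_of_hRestrict_of_unique`); on-domain invariance of the actions from `invOn_effActionHT_of_stepsOn`; then `hCompT_of_hOrbit_of_invOn`.
[cite: Balaban1987RG1, (0.21)–(0.23) p.256, (1.1)–(1.2) p.260, p.263 and (2.16) p.269; Balaban1985Variational, Thm 1 (8)–(10) p.279] -/
theorem hCompT_of_stepsOn (T : Transport F N) (χ : (K : ℕ) → (ℕ → ℝ) → (k : ℕ) → Density (F.P K) k (SU N)) {ε : ℝ} (K : ℕ) (g : ℕ → ℝ)
    {n : ℕ} (hn : n ≤ K) (D : (j : ℕ) → Set (GaugeField (F.P K) j (SU N)))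
    (hχ : ∀ j < n, LiftInvariant (χ K g j)) (hχD : ∀ j < n, ∀ U, U ∉ D j → χ K g j U = 0)
    (hstep : ∀ j < n, LiftInvariant (integrand (χ K g j) (gfOfRecord F N K j) (g j) (effActionHT F N T χ K g j)) →
      ∀ (v : GaugeTransf (F.P K) (j + 1) (SU N)) (V : GaugeField (F.P K) (j + 1) (SU N)), V ∈ D (j + 1) →
        T K j (integrand (χ K g j) (gfOfRecord F N K j) (g j) (effActionHT F N T χ K g j)) (gaugeAct v V) =
          T K j (integrand (χ K g j) (gfOfRecord F N K j) (g j) (effActionHT F N T χ K g j)) V)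
    {k : ℕ} (hk : k ≤ n) {dom : Set (GaugeField (F.P K) k (SU N))} (hres : HRestrict F N ε K k dom)
    (huniq : ∀ V ∈ dom, ∀ j < k, UniqueUkOrbit F N K (j + 1) ε (Averaging.iter (avOfRecord F N K) (j + 1) (Uk F N K k ε V)))
    (hnest : ∀ V ∈ dom, ∀ j < k, Averaging.iter (avOfRecord F N K) j (Uk F N K k ε V) ∈ D j) :
    HCompT F N T χ ε K g k dom :=
  have hn' : n ≤ (F.P K).m + (F.P K).K := hn.trans (Nat.le_add_left _ _)
  hCompT_of_hOrbit_of_invOn T χ K g (hk.trans hn') (hOrbit_of_hRestrict_of_unique F N hres huniq) D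
    (fun j hj v W hW => invOn_effActionHT_of_stepsOn T χ K g hn' D hχ hχD hstep j (hj.le.trans hk) v W hW) hnest

/-- **(1.3)∕(0.23) AT THE RECORD over a transport with the ON-DOMAIN per-step property** at the levels `< k` of run `p` (`k ≤ K`): node00-def-B's
`Node00.indAOfRecordT_atRecord` with `hcomp := hCompT_of_stepsOn` — from χ-locality, the flow recursion (0.20) up to `k`, (1.1) on the domain, `HRestrict`, intermediate
uniqueness, the nesting of the small-field domains along the averaged minimisers, lift-invariant `χ_j` vanishing off `D j`, and the on-domain per-step property (openness ∕ gauge-stability of `D (j+1)` enter only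
through the tool `stepInvOn_of_isRT_continuousOn` that discharges that property).
[cite: Balaban1987RG1, (1.1)–(1.3) p.260, (0.22)–(0.23) p.256, p.263 and (2.16) p.269; Balaban1985Variational, Thm 1 p.279] -/
theorem indAOfRecordT_atRecord_of_stepsOn (T : Transport F N) (χ : (K : ℕ) → (ℕ → ℝ) → (k : ℕ) → Density (F.P K) k (SU N)) (ε : ℝ) (β : HBeta)
    (p : B12.RunParams) (k : ℕ) (hk : k ≤ p.K) (dom : Set (GaugeField (F.P p.K) k (SU N))) (D : (j : ℕ) → Set (GaugeField (F.P p.K) j (SU N)))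
    (hχinv : ∀ j < k, LiftInvariant (χ p.K (genSeq β p.g0) j)) (hχD : ∀ j < k, ∀ U, U ∉ D j → χ p.K (genSeq β p.g0) j U = 0)
    (hstep : ∀ j < k, LiftInvariant (integrand (χ p.K (genSeq β p.g0) j) (gfOfRecord F N p.K j) (genSeq β p.g0 j)
        (effActionHT F N T χ p.K (genSeq β p.g0) j)) →
      ∀ (v : GaugeTransf (F.P p.K) (j + 1) (SU N)) (V : GaugeField (F.P p.K) (j + 1) (SU N)), V ∈ D (j + 1) →
        T p.K j (integrand (χ p.K (genSeq β p.g0) j) (gfOfRecord F N p.K j) (genSeq β p.g0 j) (effActionHT F N T χ p.K (genSeq β p.g0) j))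
            (gaugeAct v V) =
          T p.K j (integrand (χ p.K (genSeq β p.g0) j) (gfOfRecord F N p.K j) (genSeq β p.g0 j) (effActionHT F N T χ p.K (genSeq β p.g0) j)) V)
    (hχ : ∀ n ≤ k, χ p.K (extd (prefixOf (genSeq β p.g0) k)) n = χ p.K (genSeq β p.g0) n)
    (hflow : RGEqH k β (genSeq β p.g0))
    (h11 : ∀ V ∈ dom, UkExists F N p.K k ε V ∧ UniqueUkOrbit F N p.K k ε V)
    (hres : HRestrict F N ε p.K k dom)
    (huniq : ∀ V ∈ dom, ∀ j < k, UniqueUkOrbit F N p.K (j + 1) ε (Averaging.iter (avOfRecord F N p.K) (j + 1) (Uk F N p.K k ε V)))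
    (hnest : ∀ V ∈ dom, ∀ j < k, Averaging.iter (avOfRecord F N p.K) j (Uk F N p.K k ε V) ∈ D j) :
    IndAOfRecordT F N T χ ε β p k (prefixOf (genSeq β p.g0) k) dom
      (effActionOfRecordT F N T χ β p k) (wilsonBGOfRecord F N ε p k) (EkOfRecordT F N T χ ε β p k) :=
  indAOfRecordT_atRecord F N T χ ε β p k dom hχ hflow h11
    (hCompT_of_stepsOn T χ p.K (genSeq β p.g0) hk D hχinv hχD hstep le_rfl hres huniq hnest)

/-! ## §3. The Theorem-3 member through the stage-free plug over such a transport -/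

section Plug

variable {w : WorldP} {P : B12.RunParams} (T' : Transport F N) (χ : (K : ℕ) → (ℕ → ℝ) → (k : ℕ) → Density (F.P K) k (SU N)) (ε : ℝ)
  (β : HBeta) (dom : (k : ℕ) → Set (GaugeField (F.P P.K) k (SU N))) (D : (j : ℕ) → Set (GaugeField (F.P P.K) j (SU N)))
  (hflow : (w.C P).flow = genFlow β P.g0)
  (hind : ∀ k, k ≤ P.K → ((w.C P).IndAss k ↔
    IndAOfRecordT F N T' χ ε β P k (prefixOf (genSeq β P.g0) k) (dom k) (effActionOfRecordT F N T' χ β P k) (wilsonBGOfRecord F N ε P k)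
      (EkOfRecordT F N T' χ ε β P k)))
  (hχ : ∀ k, k ≤ P.K → ∀ n ≤ k, χ P.K (extd (prefixOf (genSeq β P.g0) k)) n = χ P.K (genSeq β P.g0) n)

include hflow hind hχ in
/-- **THE MEMBER OVER A TRANSPORT WITH THE ON-DOMAIN PER-STEP PROPERTY, FROM [B11] THM 1 + NESTING**: for a binding world whose run flow is `genFlow β P.g₀` and whose
`IndAss k` IS `IndAOfRecordT T' χ ε β …` at the record's own objects, with bookkeeping sets `D j` (`χ_j` lift-invariant and vanishing off `D j`),
the on-domain per-step property at the densities met, (1.1) on the domains, `HRestrict`, intermediate uniqueness and the nesting `Ū^j(U_k V) ∈ D j` (`V ∈ dom k`,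
`j < k ≤ K`), the Theorem-3 member `smallCouplings → smallFieldInductive` follows (`B12NodeKnitIndAPlug.thm3Member_of_indATPlug_of_hCompT` + `hCompT_of_stepsOn`).
[cite: Balaban1987RG1, Thm 3 p.264, (1.1)–(1.3) p.260, p.263 and (2.16) p.269; Balaban1985Variational, Thm 1 p.279] -/
theorem thm3Member_of_indATPlug_of_stepsOn
    (hχinv : ∀ j < P.K, LiftInvariant (χ P.K (genSeq β P.g0) j)) (hχD : ∀ j < P.K, ∀ U, U ∉ D j → χ P.K (genSeq β P.g0) j U = 0)
    (hstep : ∀ j < P.K, LiftInvariant (integrand (χ P.K (genSeq β P.g0) j) (gfOfRecord F N P.K j) (genSeq β P.g0 j)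
        (effActionHT F N T' χ P.K (genSeq β P.g0) j)) →
      ∀ (v : GaugeTransf (F.P P.K) (j + 1) (SU N)) (V : GaugeField (F.P P.K) (j + 1) (SU N)), V ∈ D (j + 1) →
        T' P.K j (integrand (χ P.K (genSeq β P.g0) j) (gfOfRecord F N P.K j) (genSeq β P.g0 j) (effActionHT F N T' χ P.K (genSeq β P.g0) j))
            (gaugeAct v V) =
          T' P.K j (integrand (χ P.K (genSeq β P.g0) j) (gfOfRecord F N P.K j) (genSeq β P.g0 j) (effActionHT F N T' χ P.K (genSeq β P.g0) j)) V)
    (h11 : ∀ k, k ≤ P.K → ∀ V ∈ dom k, UkExists F N P.K k ε V ∧ UniqueUkOrbit F N P.K k ε V)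
    (hres : ∀ k, k ≤ P.K → HRestrict F N ε P.K k (dom k))
    (huniq : ∀ k, k ≤ P.K → ∀ V ∈ dom k, ∀ j < k,
      UniqueUkOrbit F N P.K (j + 1) ε (Averaging.iter (avOfRecord F N P.K) (j + 1) (Uk F N P.K k ε V)))
    (hnest : ∀ k, k ≤ P.K → ∀ V ∈ dom k, ∀ j < k, Averaging.iter (avOfRecord F N P.K) j (Uk F N P.K k ε V) ∈ D j) :
    (leavesP w P).smallCouplings → (leavesP w P).smallFieldInductive :=
  thm3Member_of_indATPlug_of_hCompT T' χ ε β dom hflow hind hχ h11 fun k hk =>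
    hCompT_of_stepsOn T' χ P.K (genSeq β P.g0) le_rfl D hχinv hχD hstep hk (hres k hk) (huniq k hk) (hnest k hk)

include hflow hind hχ in
/-- **N09 AT `(w, P)` OVER SUCH A TRANSPORT**: its own leaf `b12` + the inputs of `thm3Member_of_indATPlug_of_stepsOn` ⇒ `Dag.B12_main (leavesP w P)`.
[cite: Balaban1987RG1, Lemma 4 (3.53) p.280, Thm 3 p.264 and (1.1)–(1.3) p.260] -/
theorem b12_main_of_indATPlug_of_leaf_of_stepsOn (h12 : (leavesP w P).b12)
    (hχinv : ∀ j < P.K, LiftInvariant (χ P.K (genSeq β P.g0) j)) (hχD : ∀ j < P.K, ∀ U, U ∉ D j → χ P.K (genSeq β P.g0) j U = 0)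
    (hstep : ∀ j < P.K, LiftInvariant (integrand (χ P.K (genSeq β P.g0) j) (gfOfRecord F N P.K j) (genSeq β P.g0 j)
        (effActionHT F N T' χ P.K (genSeq β P.g0) j)) →
      ∀ (v : GaugeTransf (F.P P.K) (j + 1) (SU N)) (V : GaugeField (F.P P.K) (j + 1) (SU N)), V ∈ D (j + 1) →
        T' P.K j (integrand (χ P.K (genSeq β P.g0) j) (gfOfRecord F N P.K j) (genSeq β P.g0 j) (effActionHT F N T' χ P.K (genSeq β P.g0) j))
            (gaugeAct v V) =
          T' P.K j (integrand (χ P.K (genSeq β P.g0) j) (gfOfRecord F N P.K j) (genSeq β P.g0 j) (effActionHT F N T' χ P.K (genSeq β P.g0) j)) V)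
    (h11 : ∀ k, k ≤ P.K → ∀ V ∈ dom k, UkExists F N P.K k ε V ∧ UniqueUkOrbit F N P.K k ε V)
    (hres : ∀ k, k ≤ P.K → HRestrict F N ε P.K k (dom k))
    (huniq : ∀ k, k ≤ P.K → ∀ V ∈ dom k, ∀ j < k,
      UniqueUkOrbit F N P.K (j + 1) ε (Averaging.iter (avOfRecord F N P.K) (j + 1) (Uk F N P.K k ε V)))
    (hnest : ∀ k, k ≤ P.K → ∀ V ∈ dom k, ∀ j < k, Averaging.iter (avOfRecord F N P.K) j (Uk F N P.K k ε V) ∈ D j) :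
    Dag.B12_main (leavesP w P) :=
  b12_main_of_leaf_of_thm3Member h12
    (thm3Member_of_indATPlug_of_stepsOn T' χ ε β dom D hflow hind hχ hχinv hχD hstep h11 hres huniq hnest)

end Plug


/-! ## §4. At def-χ's fixed-threshold χ and the record's own small-field domains `domAltOfRecord` -/

section RecordDomains

/-- `dist1 = ‖· − 1‖` is continuous on `SU(N)` (operator norm of the fundamental representation). [cite: Balaban1985Averaging, (19) p.21 (bookkeeping)] -/
theorem continuous_dist1_SU : Continuous (dist1 : SU N → ℝ) :=
  UnitaryModel.continuous_opDist1.comp (Literature.MathematicalPhysics.QuantumLattice.continuous_fundamentalRep (Fin N))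

/-- Plaquette variables are continuous in the configuration (finite products and inverses in the topological group `SU(N)`). [cite: Balaban1985Averaging, (9) p.19 (bookkeeping)] -/
theorem continuous_plaqHol_SU {P : Params} {j : ℕ} (p : Plaq P j) : Continuous fun U : GaugeField P j (SU N) => GaugeField.plaqHol U p := by
  have hb : ∀ b : PBond P j, Continuous fun U : GaugeField P j (SU N) => U b := fun b => continuous_apply b
  unfold GaugeField.plaqHol
  exact (((hb _).mul (hb _)).mul (hb _).inv).mul (hb _).inv

/-- **THE RECORD'S SMALL-FIELD DOMAIN `{V : |V(∂p) − 1| < ε₀ ∀p}` IS OPEN** (finitely many strict inequalities of continuous functions). [cite: Balaban1987RG1, p.259 and (1.2) p.260] -/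
theorem isOpen_domAltOfRecord (ν : Stage7Numerics) (K k : ℕ) : IsOpen (domAltOfRecord F N ν K k) := by
  have h : domAltOfRecord F N ν K k = ⋂ p : Plaq (F.P K) k, {V | dist1 (GaugeField.plaqHol V p) < ν.ε₀} := by
    ext V
    simp only [mem_domAltOfRecord_iff, PlaqSmall, Set.mem_iInter, Set.mem_setOf_eq]
  rw [h]
  exact isOpen_iInter_of_finite fun p => isOpen_lt (continuous_dist1_SU.comp (continuous_plaqHol_SU p)) continuous_const

/-- **THE RECORD'S SMALL-FIELD DOMAIN IS GAUGE-STABLE** (plaquette variables are conjugated, `dist1` is conjugation invariant —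
`T4ReTrLipUnitary.plaqSmall_gaugeAct_iff`). [cite: Balaban1987RG1, p.259 and (0.21) p.256] -/
theorem domAltOfRecord_gaugeAct_mem (ν : Stage7Numerics) (K k : ℕ) (u : GaugeTransf (F.P K) k (SU N)) (V : GaugeField (F.P K) k (SU N))
    (hV : V ∈ domAltOfRecord F N ν K k) : gaugeAct u V ∈ domAltOfRecord F N ν K k :=
  (mem_domAltOfRecord_iff F N ν K k _).2 ((T4ReTrLipUnitary.plaqSmall_gaugeAct_iff ν.ε₀ u V).2 ((mem_domAltOfRecord_iff F N ν K k V).1 hV))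

/-- **def-χ's χ VANISHES OFF THE DOMAIN** (`chiFixed7 ν K g k = chiFixAltOfRecord ν K k ∈ {0,1}`, `= 1` iff in `domAltOfRecord`). [cite: Balaban1987RG1, p.259 (bookkeeping)] -/
theorem chiFixed7_eq_zero_of_not_mem (ν : Stage7Numerics) (K : ℕ) (g : ℕ → ℝ) (k : ℕ) (V : GaugeField (F.P K) k (SU N))
    (hV : V ∉ domAltOfRecord F N ν K k) : chiFixed7 F N ν K g k V = 0 := by
  rcases chiFixAltOfRecord_eq_zero_or_one ν K k V with h | h
  · exact h
  · exact absurd ((chiFixAltOfRecord_eq_one_iff_mem ν K k V).1 h) hV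

/-- **`HCompT` OVER ANY TRANSPORT, AT def-χ's χ AND THE RECORD'S DOMAINS, from the [B11] binders + nesting + the per-step ON-DOMAIN continuity of the images**
(levels `k ≤ n ≤ K` of the `K`-th torus): per step `j < n` only «`T K j ρ_j` is an `IsRT` image of the (0.19) density met, integrable, and CONTINUOUS ON
`domAltOfRecord ν K (j+1)`»; openness, gauge-stability and the vanishing of χ off the domain are §4's theorems. [cite: Balaban1987RG1, (0.21)–(0.23) p.256, (1.1)–(1.2) p.260, p.263 and (2.16) p.269; Balaban1985Variational, Thm 1 (8)–(10) p.279] -/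
theorem hCompT_of_stepsOn_chiFixed7 (T : Transport F N) (ν : Stage7Numerics) {ε : ℝ} (K : ℕ) (g : ℕ → ℝ) {n : ℕ} (hn : n ≤ K)
    (hstep : ∀ j < n,
      IsRT (avOfRecord F N K j).avg
          (integrand (chiFixed7 F N ν K g j) (gfOfRecord F N K j) (g j) (effActionHT F N T (chiFixed7 F N ν) K g j))
          (T K j (integrand (chiFixed7 F N ν K g j) (gfOfRecord F N K j) (g j) (effActionHT F N T (chiFixed7 F N ν) K g j))) ∧
        Integrable (T K j (integrand (chiFixed7 F N ν K g j) (gfOfRecord F N K j) (g j) (effActionHT F N T (chiFixed7 F N ν) K g j)))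
          (fieldMeasure (F.P K) (j + 1) (SU N)) ∧
        ContinuousOn (T K j (integrand (chiFixed7 F N ν K g j) (gfOfRecord F N K j) (g j) (effActionHT F N T (chiFixed7 F N ν) K g j)))
          (domAltOfRecord F N ν K (j + 1)))
    {k : ℕ} (hk : k ≤ n) {dom : Set (GaugeField (F.P K) k (SU N))} (hres : HRestrict F N ε K k dom)
    (huniq : ∀ V ∈ dom, ∀ j < k, UniqueUkOrbit F N K (j + 1) ε (Averaging.iter (avOfRecord F N K) (j + 1) (Uk F N K k ε V)))
    (hnest : ∀ V ∈ dom, ∀ j < k, Averaging.iter (avOfRecord F N K) j (Uk F N K k ε V) ∈ domAltOfRecord F N ν K j) :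
    HCompT F N T (chiFixed7 F N ν) ε K g k dom :=
  hCompT_of_stepsOn T (chiFixed7 F N ν) K g hn (fun j => domAltOfRecord F N ν K j) (fun j _ => B12NodeKnitContinuousTransport.liftInvariant_chiFixed7 ν K g j)
    (fun j _ U hU => chiFixed7_eq_zero_of_not_mem ν K g j U hU)
    (fun j hj => stepInvOn_of_isRT_continuousOn T (chiFixed7 F N ν) K g ((Nat.succ_le_of_lt hj).trans (hn.trans (Nat.le_add_left _ _)))
      (isOpen_domAltOfRecord ν K (j + 1)) (fun v V hV => domAltOfRecord_gaugeAct_mem ν K (j + 1) v V hV) (hstep j hj).1 (hstep j hj).2.1 (hstep j hj).2.2)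
    hk hres huniq hnest

variable {w : WorldP} {P : B12.RunParams} (T' : Transport F N) (ν : Stage7Numerics) (ε : ℝ) (β : HBeta)
  (dom : (k : ℕ) → Set (GaugeField (F.P P.K) k (SU N)))
  (hflow : (w.C P).flow = genFlow β P.g0)
  (hind : ∀ k, k ≤ P.K → ((w.C P).IndAss k ↔
    IndAOfRecordT F N T' (chiFixed7 F N ν) ε β P k (prefixOf (genSeq β P.g0) k) (dom k) (effActionOfRecordT F N T' (chiFixed7 F N ν) β P k)
      (wilsonBGOfRecord F N ε P k) (EkOfRecordT F N T' (chiFixed7 F N ν) ε β P k)))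

include hflow hind in
/-- **THE THEOREM-3 MEMBER OVER ANY TRANSPORT WITH IMAGES CONTINUOUS ON THE RECORD'S SMALL-FIELD DOMAINS** (def-χ's χ; a binding world whose `IndAss` reads
`IndAOfRecordT T' (chiFixed7 ν) ε β …`): from (1.1) on the domains, `HRestrict`, intermediate uniqueness, the nesting `Ū^j(U_k V) ∈ domAltOfRecord ν K j` and, per step
`j < K`, «`T' K j ρ_j` is an integrable `IsRT` image continuous ON `domAltOfRecord ν K (j+1)`» — the ON-DOMAIN form of the continuity proviso suffices for N09.
[cite: Balaban1987RG1, Thm 3 p.264, (1.1)–(1.3) p.260, p.263 and (2.16) p.269; Balaban1985Variational, Thm 1 p.279] -/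
theorem thm3Member_of_indATPlug_of_stepsOn_chiFixed7
    (hstep : ∀ j < P.K,
      IsRT (avOfRecord F N P.K j).avg
          (integrand (chiFixed7 F N ν P.K (genSeq β P.g0) j) (gfOfRecord F N P.K j) (genSeq β P.g0 j)
            (effActionHT F N T' (chiFixed7 F N ν) P.K (genSeq β P.g0) j))
          (T' P.K j (integrand (chiFixed7 F N ν P.K (genSeq β P.g0) j) (gfOfRecord F N P.K j) (genSeq β P.g0 j)
            (effActionHT F N T' (chiFixed7 F N ν) P.K (genSeq β P.g0) j))) ∧
        Integrable (T' P.K j (integrand (chiFixed7 F N ν P.K (genSeq β P.g0) j) (gfOfRecord F N P.K j) (genSeq β P.g0 j)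
            (effActionHT F N T' (chiFixed7 F N ν) P.K (genSeq β P.g0) j))) (fieldMeasure (F.P P.K) (j + 1) (SU N)) ∧
        ContinuousOn (T' P.K j (integrand (chiFixed7 F N ν P.K (genSeq β P.g0) j) (gfOfRecord F N P.K j) (genSeq β P.g0 j)
            (effActionHT F N T' (chiFixed7 F N ν) P.K (genSeq β P.g0) j))) (domAltOfRecord F N ν P.K (j + 1)))
    (h11 : ∀ k, k ≤ P.K → ∀ V ∈ dom k, UkExists F N P.K k ε V ∧ UniqueUkOrbit F N P.K k ε V)
    (hres : ∀ k, k ≤ P.K → HRestrict F N ε P.K k (dom k))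
    (huniq : ∀ k, k ≤ P.K → ∀ V ∈ dom k, ∀ j < k,
      UniqueUkOrbit F N P.K (j + 1) ε (Averaging.iter (avOfRecord F N P.K) (j + 1) (Uk F N P.K k ε V)))
    (hnest : ∀ k, k ≤ P.K → ∀ V ∈ dom k, ∀ j < k, Averaging.iter (avOfRecord F N P.K) j (Uk F N P.K k ε V) ∈ domAltOfRecord F N ν P.K j) :
    (leavesP w P).smallCouplings → (leavesP w P).smallFieldInductive :=
  thm3Member_of_indATPlug_of_hCompT T' (chiFixed7 F N ν) ε β dom hflow hind (fun _ _ _ _ => rfl) h11 fun k hk =>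
    hCompT_of_stepsOn_chiFixed7 T' ν P.K (genSeq β P.g0) le_rfl hstep hk (hres k hk) (huniq k hk) (hnest k hk)

end RecordDomains

end Literature.MathematicalPhysics.QuantumFieldTheory.Balaban1983to89.B12ContinuousTransportInvarianceOn

end
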